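import Summits.QuantumFields.BalabanUV.Beta.GAN24.SrecAtBornRowHolds
import Summits.QuantumFields.BalabanUV.Beta.GAN24.BornBorderContactBound

/-!
# GAN24 ∕ CT-ROUTE — `SrecAtRowHoldsFinal`: `hS0` OF THE `d = 3` COMB FAMILY, UNCONDITIONALLY

NOT IN PRINT; OUR BOOKKEEPING ([folklore] assembly BY NAME; no estimate of Bałaban's is formalised, cited or discharged here).
HONEST: hS0 (the single-level local-stencil row of every member of the comb family (E) = `WardLocusRecursive.SrecAt` in its adopted units, uniformly in the level and the in-block
root) is a THEOREM of the tree after this file; it is NOT (hS, hSall) of the comb family ((hSall) = CT-4, OPEN), NOT the symmetric family of the wall (CT-5, OPEN), NOT (CONV-C);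
NEVER «G-an2-4 closed»; NOT D1, NOT `BetaPertH`, NOT continuum, NOT Clay.

WHAT.  The owner's capstone `SrecAtBornRowHolds.exists_hS0_SrecAt_three_of_contact` (hS0 ⇐ the per-lineage V contact letter `hCgV`) with leaf-03 g55's (C4)-V END
`BornBorderContactBound.exists_hCgV_three` (the letter, `p = 1`) plugged in BY NAME: `exists_hBv_three` (hB(cVH,0)), `exists_hB_three` (hB), `exists_hS0_SrecAt_three` (hS0).

Unit `b2b-balaban-gan24-p1` (row owner G-an2-4, gen 21), 2026-08-21.
-/

noncomputable section

open Literature.MathematicalPhysics.QuantumFieldTheory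
open Literature.MathematicalPhysics.QuantumFieldTheory.Balaban1983to89
open Literature.MathematicalPhysics.QuantumFieldTheory.Balaban1983to89.Beta
open OneStepResolventKernel (LocStencil)
open AffineAveraging (box toSite)
open Summit.QuantumFields.BalabanUV.Beta.HessKerDressedUnits (unitS)
open Summit.QuantumFields.BalabanUV.Beta.GAN24.CombesThomas (sfStep smStep)
open Summit.QuantumFields.BalabanUV.Beta.GAN24.SrecWilsonSector (bornSecAt)
open Summit.QuantumFields.BalabanUV.Beta.WardLocusRecursive (SrecAt)
open Summit.QuantumFields.BalabanUV.Beta.GAN24.SrecAtBornRowHolds (exists_hBv_three_of_contact_poly exists_hB_three_of_contact exists_hS0_SrecAt_three_of_contact)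
open Summit.QuantumFields.BalabanUV.Beta.GAN24.BornBorderContactBound (exists_hCgV_three)

namespace Summit.QuantumFields.BalabanUV.Beta.GAN24.SrecAtRowHoldsFinal

variable {Lc : ℕ} [NeZero Lc]

omit [NeZero Lc] in
/-- [folklore] The pin `cE = Lc^4` meets the contact letter's hypothesis `|cE| ≤ Lc^4`. -/
theorem abs_cE_le {cE : ℝ} (hcE : cE = (Lc : ℝ) ^ (3 + 1)) : |cE| ≤ (Lc : ℝ) ^ 4 := by
  rw [hcE, abs_of_nonneg (by positivity)]

/-- NOT IN PRINT; OUR PROOF ATTEMPT ([folklore] assembly; UNCONDITIONAL).  **THE V-BORN ROW `hB(cVH, 0)` OF THE `d = 3` COMB FAMILY HOLDS** (`Lc ≥ 2`, pin `cE = Lc^4`, every `cVH`,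
uniformly in the in-block root): the owner's V socket over gan24-p2's symmetric-table rooted rows, with leaf-03 g55's contact letter `exists_hCgV_three` (`p = 1`). -/
theorem exists_hBv_three (hLc : 2 ≤ Lc) {cE : ℝ} (hcE : cE = (Lc : ℝ) ^ (3 + 1)) (cVH : ℝ) :
    ∃ C δ : ℝ, 0 < δ ∧ ∀ (rr : Fin (3 + 1) → ℕ), rr ∈ box (3 + 1) Lc →
      ∀ k : ℕ, LocStencil (unitS (sfStep Lc k) (smStep 3 Lc k) (bornSecAt Lc (toSite rr) cE cVH 0 k)) C δ :=
  exists_hBv_three_of_contact_poly hLc hcE cVH 1 (exists_hCgV_three hLc cE cVH (abs_cE_le hcE))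

/-- NOT IN PRINT; OUR PROOF ATTEMPT ([folklore] assembly; UNCONDITIONAL).  **THE BORN ROW hB OF THE `d = 3` COMB FAMILY HOLDS** (both halves: leaf-04 g56's
`BornLambdaSectorRowHolds.exists_hBLam_three` and `exists_hBv_three`, added by leaf-01's `BornLambdaLineage.exists_hB_of_sectors`). -/
theorem exists_hB_three (hLc : 2 ≤ Lc) {cE : ℝ} (hcE : cE = (Lc : ℝ) ^ (3 + 1)) (cVH cΛ : ℝ) :
    ∃ C δ : ℝ, 0 < δ ∧ ∀ (rr : Fin (3 + 1) → ℕ), rr ∈ box (3 + 1) Lc →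
      ∀ j : ℕ, LocStencil (unitS (sfStep Lc j) (smStep 3 Lc j) (bornSecAt Lc (toSite rr) cE cVH cΛ j)) C δ :=
  exists_hB_three_of_contact hLc hcE cVH cΛ 1 (exists_hCgV_three hLc cE cVH (abs_cE_le hcE))

/-- NOT IN PRINT; OUR PROOF ATTEMPT ([folklore] assembly; UNCONDITIONAL).  **hS0 OF THE `d = 3` COMB FAMILY (E) = `WardLocusRecursive.SrecAt` HOLDS**: for every `Lc ≥ 2`, the pin
`cE = Lc^4`, every `cVH cΛ`, there are `Cs, δS > 0` with `LocStencil (unitS (sfStep Lc j) (smStep 3 Lc j) (SrecAt 3 Lc (toSite rr) cE cVH cΛ j)) Cs δS` for EVERY level `j` and EVERY in-block root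
`rr ∈ box (3+1) Lc` — the Wilson row (gen 19, `WilsonSectorRowHolds.exists_hS0_wilsonSec`), the Born row (`exists_hB_three`), added by `SrecAtRowOfSectors.exists_hS0_SrecAt_of_sectors`.
hS0 is the FIRST of the two CT-4 hypotheses of `SrecAtStability`; (hSall) is OPEN. -/
theorem exists_hS0_SrecAt_three (hLc : 2 ≤ Lc) {cE : ℝ} (hcE : cE = (Lc : ℝ) ^ (3 + 1)) (cVH cΛ : ℝ) :
    ∃ Cs δS : ℝ, 0 < δS ∧ ∀ (rr : Fin (3 + 1) → ℕ), rr ∈ box (3 + 1) Lc →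
      ∀ j : ℕ, LocStencil (unitS (sfStep Lc j) (smStep 3 Lc j) (SrecAt 3 Lc (toSite rr) cE cVH cΛ j)) Cs δS :=
  exists_hS0_SrecAt_three_of_contact hLc hcE cVH cΛ 1 (exists_hCgV_three hLc cE cVH (abs_cE_le hcE))

end Summit.QuantumFields.BalabanUV.Beta.GAN24.SrecAtRowHoldsFinal

end
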